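import Mathlib.Combinatorics.SetFamily.FourFunctions
import Mathlib.Combinatorics.SetFamily.Compression.UV
import Mathlib.Data.Finset.Sups
import Mathlib.Order.UpperLower.Basic

/-!
# `NoHeavyLowerTail` (crux stmt-CriticalPhenomena-4575), lane prim-ineq-gen-4 (gen 34): the outer shell is a sublattice of the DOMINANCE lattice —
# (AB_l) for EQUALLY shifted pairs by Daykin's inequality

Support file (`--supports stmt-CriticalPhenomena-4575`; memo `run/shared/lean/prim/prim-ineq-gen-4/FINDING-CYLINDER-g34.md` §3).
No definitions, no `sorry`, standard axioms.

The anti-band inequality (AB_l): `#{s ∈ W ∩ Vᶜˢ | outer s} ≤ #{s ∈ W ∩ V | outer s}`, `outer s :↔ #s < l ∨ #sᶜ < l`, for upper sets `W, V ⊆ 2^{Fin n}`.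
Gen 20 (`AntiBandShift`) showed that the functional decreases under OPPOSITE compressions, so the conjecture reduces to `W` left-shifted against `V`
right-shifted.  This file settles the opposite polarity: **if `W` and `V` are BOTH left-shifted (compressed along `({i},{j})` for all `i < j`), then
(AB_l)(W, V) holds for every `l`** (`antiBand_of_both_leftShifted`).

Mechanism (memo §3).  Send a set `x` to its prefix-count vector `E x : Fin (n+1) → ℕ`, `E x k = #{a ∈ x | a < k}`.  Pointwise `max`/`min` of two prefix-count
vectors is again a prefix-count vector (`exists_prefix_eq_max/min`), of a set of size `max/min(#x, #y)`; so the outer shell `O` is a sublattice of the distributive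
lattice `Fin (n+1) → ℕ` (it is NOT closed under `∪`, which is why Harris' inequality fails on `O`).  A left-shifted upper set is an upper set for the prefix-count
order (`mem_of_prefix_le`: exchange argument), and so is `{x ∈ O | xᶜ ∉ V}`.  Daykin's inequality `#s·#t ≤ #(s ⊼ t)·#(s ⊻ t)` (Mathlib
`Finset.le_card_infs_mul_card_sups`) then gives positive correlation of any two such families inside `O` (`card_mul_le_of_prefixUp`), and (AB_l) is the sum of two
such correlations because `#(V ∩ O) + #{x ∈ O | xᶜ ∉ V} = #O`.
-/

namespace Summit.CriticalPhenomena.PercolationContinuityZ3.Theorems.AntiBandDominance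

open Finset
open scoped FinsetFamily

variable {n : ℕ}

/-- Prefix counts grow by `0` or `1`: `#{a ∈ x | a < k+1} = #{a ∈ x | a < k} + [⟨k⟩ ∈ x]` for `k < n`. [elementary] -/
theorem card_filter_lt_succ (x : Finset (Fin n)) (k : ℕ) (hk : k < n) :
    #(x.filter fun a : Fin n => (a : ℕ) < k + 1) = #(x.filter fun a : Fin n => (a : ℕ) < k) + (if (⟨k, hk⟩ : Fin n) ∈ x then 1 else 0) := by
  have hsplit : x.filter (fun a : Fin n => (a : ℕ) < k + 1) = x.filter (fun a : Fin n => (a : ℕ) < k) ∪ x.filter (fun a : Fin n => a = ⟨k, hk⟩) := by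
    ext a; simp only [mem_filter, mem_union, Fin.ext_iff]
    constructor
    · rintro ⟨h1, h2⟩
      by_cases h3 : (a : ℕ) < k
      · exact Or.inl ⟨h1, h3⟩
      · exact Or.inr ⟨h1, by omega⟩
    · rintro (⟨h1, h2⟩ | ⟨h1, h2⟩)
      · exact ⟨h1, by omega⟩
      · exact ⟨h1, by omega⟩
  have hdisj : Disjoint (x.filter fun a : Fin n => (a : ℕ) < k) (x.filter fun a => a = ⟨k, hk⟩) := by
    rw [disjoint_filter]; intro a _ h1 h2; rw [h2] at h1; exact lt_irrefl _ h1
  rw [hsplit, card_union_of_disjoint hdisj]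
  congr 1
  by_cases h : (⟨k, hk⟩ : Fin n) ∈ x
  · rw [if_pos h]; rw [card_eq_one]; exact ⟨⟨k, hk⟩, by ext a; simp only [mem_filter, mem_singleton]; exact ⟨fun h' => h'.2, fun h' => ⟨h' ▸ h, h'⟩⟩⟩
  · rw [if_neg h, card_eq_zero, filter_eq_empty_iff]; intro a ha hak; exact h (hak ▸ ha)

/-- Beyond `n` the prefix count is `#x`. [elementary] -/
theorem card_filter_lt_of_le (x : Finset (Fin n)) (k : ℕ) (hk : n ≤ k) : #(x.filter fun a : Fin n => (a : ℕ) < k) = #x := by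
  rw [filter_true_of_mem]; intro a _; exact lt_of_lt_of_le a.2 hk

/-- **Joins in the dominance lattice.**  For any `x, y` there is `z` whose prefix counts are the pointwise `max` of those of `x` and `y` (then `#z = max #x #y`).
[this work, memo §3.1] -/
theorem exists_prefix_eq_max (x y : Finset (Fin n)) :
    ∃ z : Finset (Fin n), ∀ k : ℕ, #(z.filter fun a : Fin n => (a : ℕ) < k) = max #(x.filter fun a : Fin n => (a : ℕ) < k) #(y.filter fun a : Fin n => (a : ℕ) < k) := by
  classical
  set P : Finset (Fin n) → ℕ → ℕ := fun s k => #(s.filter fun a : Fin n => (a : ℕ) < k) with hP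
  refine ⟨univ.filter fun i : Fin n => max (P x (i + 1)) (P y (i + 1)) = max (P x i) (P y i) + 1, ?_⟩
  set z := univ.filter fun i : Fin n => max (P x (i + 1)) (P y (i + 1)) = max (P x i) (P y i) + 1 with hz
  have hle : ∀ k : ℕ, k ≤ n → P z k = max (P x k) (P y k) := by
    intro k
    induction k with
    | zero => intro _; simp only [hP, Nat.not_lt_zero, filter_false, card_empty, Nat.zero_max]
    | succ k ih =>
      intro hk
      have hk' : k < n := hk
      have h1 := card_filter_lt_succ x k hk'; have h2 := card_filter_lt_succ y k hk'; have h3 := card_filter_lt_succ z k hk'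
      have ihk := ih hk'.le
      simp only [hP] at ihk ⊢
      rw [h3, ihk]
      have hzmem : (⟨k, hk'⟩ : Fin n) ∈ z ↔ max (P x (k + 1)) (P y (k + 1)) = max (P x k) (P y k) + 1 := by
        rw [hz, mem_filter]; simp only [mem_univ, true_and]
      simp only [hP] at hzmem
      by_cases hx : (⟨k, hk'⟩ : Fin n) ∈ x <;> by_cases hy : (⟨k, hk'⟩ : Fin n) ∈ y <;>
        simp only [hx, hy, if_true, if_false] at h1 h2 ⊢ <;> rw [h1, h2] at hzmem ⊢ <;>
        by_cases hzk : (⟨k, hk'⟩ : Fin n) ∈ z <;> simp only [hzk, if_true, if_false] <;> rw [hzmem] at hzk <;> omega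
  intro k
  by_cases hk : k ≤ n
  · exact hle k hk
  · push Not at hk
    simp only [hP] at hle
    rw [card_filter_lt_of_le z k hk.le, card_filter_lt_of_le x k hk.le, card_filter_lt_of_le y k hk.le,
      ← card_filter_lt_of_le z n le_rfl, ← card_filter_lt_of_le x n le_rfl, ← card_filter_lt_of_le y n le_rfl]
    exact hle n le_rfl

/-- **Meets in the dominance lattice** (pointwise `min` of prefix counts). [this work, memo §3.1] -/
theorem exists_prefix_eq_min (x y : Finset (Fin n)) :
    ∃ z : Finset (Fin n), ∀ k : ℕ, #(z.filter fun a : Fin n => (a : ℕ) < k) = min #(x.filter fun a : Fin n => (a : ℕ) < k) #(y.filter fun a : Fin n => (a : ℕ) < k) := by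
  classical
  set P : Finset (Fin n) → ℕ → ℕ := fun s k => #(s.filter fun a : Fin n => (a : ℕ) < k) with hP
  refine ⟨univ.filter fun i : Fin n => min (P x (i + 1)) (P y (i + 1)) = min (P x i) (P y i) + 1, ?_⟩
  set z := univ.filter fun i : Fin n => min (P x (i + 1)) (P y (i + 1)) = min (P x i) (P y i) + 1 with hz
  have hle : ∀ k : ℕ, k ≤ n → P z k = min (P x k) (P y k) := by
    intro k
    induction k with
    | zero => intro _; simp only [hP, Nat.not_lt_zero, filter_false, card_empty, Nat.zero_min]
    | succ k ih =>
      intro hk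
      have hk' : k < n := hk
      have h1 := card_filter_lt_succ x k hk'; have h2 := card_filter_lt_succ y k hk'; have h3 := card_filter_lt_succ z k hk'
      have ihk := ih hk'.le
      simp only [hP] at ihk ⊢
      rw [h3, ihk]
      have hzmem : (⟨k, hk'⟩ : Fin n) ∈ z ↔ min (P x (k + 1)) (P y (k + 1)) = min (P x k) (P y k) + 1 := by
        rw [hz, mem_filter]; simp only [mem_univ, true_and]
      simp only [hP] at hzmem
      by_cases hx : (⟨k, hk'⟩ : Fin n) ∈ x <;> by_cases hy : (⟨k, hk'⟩ : Fin n) ∈ y <;>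
        simp only [hx, hy, if_true, if_false] at h1 h2 ⊢ <;> rw [h1, h2] at hzmem ⊢ <;>
        by_cases hzk : (⟨k, hk'⟩ : Fin n) ∈ z <;> simp only [hzk, if_true, if_false] <;> rw [hzmem] at hzk <;> omega
  intro k
  by_cases hk : k ≤ n
  · exact hle k hk
  · push Not at hk
    simp only [hP] at hle
    rw [card_filter_lt_of_le z k hk.le, card_filter_lt_of_le x k hk.le, card_filter_lt_of_le y k hk.le,
      ← card_filter_lt_of_le z n le_rfl, ← card_filter_lt_of_le x n le_rfl, ← card_filter_lt_of_le y n le_rfl]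
    exact hle n le_rfl

/-- **Left-shifted upper sets are upper sets of the dominance order.**  If `W` is an upper set compressed along `({i},{j})` for all `i < j`, `x ∈ W`, and every prefix
count of `y` is at least that of `x`, then `y ∈ W` (exchange argument: move the least element of `x \ y` down onto an element of `y \ x` below it).
[folklore; memo §3.4(ii)] -/
theorem mem_of_prefix_le (W : Finset (Finset (Fin n))) (hW : IsUpperSet (W : Set (Finset (Fin n))))
    (hsh : ∀ i j : Fin n, i < j → UV.IsCompressed ({i} : Finset (Fin n)) {j} W) :
    ∀ (d : ℕ) (x y : Finset (Fin n)), #(x \ y) = d → x ∈ W →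
      (∀ k : ℕ, #(x.filter fun a : Fin n => (a : ℕ) < k) ≤ #(y.filter fun a : Fin n => (a : ℕ) < k)) → y ∈ W := by
  classical
  intro d
  induction d with
  | zero =>
    intro x y hd hx _
    rw [card_eq_zero, sdiff_eq_empty_iff_subset] at hd
    exact hW hd hx
  | succ d ih =>
    intro x y hd hx hle
    have hne : (x \ y).Nonempty := by rw [← card_pos, hd]; exact Nat.succ_pos d
    set j : Fin n := (x \ y).min' hne with hjdef
    have hj : j ∈ x \ y := min'_mem _ hne
    rw [mem_sdiff] at hj
    -- elements of `x` below `j` lie in `y`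
    have hbelow : ∀ k : ℕ, k ≤ (j : ℕ) → x.filter (fun a : Fin n => (a : ℕ) < k) ⊆ y.filter (fun a : Fin n => (a : ℕ) < k) := by
      intro k hk a ha
      rw [mem_filter] at ha ⊢
      refine ⟨?_, ha.2⟩
      by_contra hay
      have hmin : j ≤ a := min'_le _ a (mem_sdiff.2 ⟨ha.1, hay⟩)
      have : (j : ℕ) ≤ (a : ℕ) := hmin
      omega
    -- an element `i ∈ y \ x` below `j`
    have hlt : #(x.filter fun a : Fin n => (a : ℕ) < j) < #(y.filter fun a : Fin n => (a : ℕ) < j) := by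
      have h1 := hle ((j : ℕ) + 1)
      rw [card_filter_lt_succ x j j.2, card_filter_lt_succ y j j.2, if_pos hj.1, if_neg hj.2] at h1
      omega
    obtain ⟨i, hiy, hix⟩ := exists_mem_notMem_of_card_lt_card hlt
    rw [mem_filter] at hiy
    have hix' : i ∉ x := fun h => hix (mem_filter.2 ⟨h, hiy.2⟩)
    have hij : i < j := hiy.2
    -- the shifted set
    set x' : Finset (Fin n) := insert i (x.erase j) with hx'def
    have hx'W : x' ∈ W := by
      have hc : UV.compress ({i} : Finset (Fin n)) {j} x = x' := by
        rw [UV.compress_of_disjoint_of_le (disjoint_singleton_left.2 hix') (singleton_subset_iff.2 hj.1)]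
        ext a
        rw [mem_sdiff, sup_eq_union, mem_union, mem_singleton, mem_singleton, hx'def, mem_insert, mem_erase]
        constructor
        · rintro ⟨h1 | h1, h2⟩; exacts [Or.inr ⟨h2, h1⟩, Or.inl h1]
        · rintro (h1 | ⟨h1, h2⟩)
          exacts [⟨Or.inr h1, fun h => absurd hij (by rw [show i = j from h1.symm.trans h]; exact lt_irrefl j)⟩, ⟨Or.inl h2, h1⟩]
      have h := UV.compress_mem_compression (u := ({i} : Finset (Fin n))) (v := {j}) hx
      rw [hc] at h
      have hcomp := hsh i j hij
      rw [UV.IsCompressed] at hcomp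
      rwa [hcomp] at h
    have hcard : #(x' \ y) = d := by
      have : x' \ y = (x \ y).erase j := by
        ext a
        rw [hx'def, mem_sdiff, mem_insert, mem_erase, mem_erase, mem_sdiff]
        constructor
        · rintro ⟨h1 | ⟨h1, h2⟩, h3⟩
          · exact absurd hiy.1 (h1 ▸ h3)
          · exact ⟨h1, h2, h3⟩
        · rintro ⟨h1, h2, h3⟩; exact ⟨Or.inr ⟨h1, h2⟩, h3⟩
      rw [this, card_erase_of_mem (mem_sdiff.2 hj), hd]; rfl
    refine ih x' y hcard hx'W fun k => ?_
    -- prefix counts of `x'`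
    by_cases hk : k ≤ (j : ℕ)
    · -- below `j`: `x'` agrees with `x` plus possibly `i`
      have hsub : x'.filter (fun a : Fin n => (a : ℕ) < k) ⊆ y.filter (fun a : Fin n => (a : ℕ) < k) := by
        intro a ha
        rw [mem_filter, hx'def, mem_insert, mem_erase] at ha
        rcases ha with ⟨h1 | ⟨_, h2⟩, h3⟩
        · exact mem_filter.2 ⟨h1 ▸ hiy.1, h3⟩
        · exact hbelow k hk (mem_filter.2 ⟨h2, h3⟩)
      exact card_le_card hsub
    · push Not at hk
      have heq : #(x'.filter fun a : Fin n => (a : ℕ) < k) = #(x.filter fun a : Fin n => (a : ℕ) < k) := by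
        have h1 : x'.filter (fun a : Fin n => (a : ℕ) < k) = insert i ((x.filter fun a : Fin n => (a : ℕ) < k).erase j) := by
          ext a
          rw [mem_filter, hx'def, mem_insert, mem_erase, mem_insert, mem_erase, mem_filter]
          constructor
          · rintro ⟨h1 | ⟨h2, h3⟩, h4⟩
            · exact Or.inl h1
            · exact Or.inr ⟨h2, h3, h4⟩
          · rintro (h1 | ⟨h2, h3, h4⟩)
            · refine ⟨Or.inl h1, ?_⟩; rw [h1]; have : (i : ℕ) < (j : ℕ) := hij; omega
            · exact ⟨Or.inr ⟨h2, h3⟩, h4⟩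
        rw [h1, card_insert_of_notMem, card_erase_of_mem (mem_filter.2 ⟨hj.1, hk⟩)]
        · have : 0 < #(x.filter fun a : Fin n => (a : ℕ) < k) := card_pos.2 ⟨j, mem_filter.2 ⟨hj.1, hk⟩⟩
          omega
        · rw [mem_erase, mem_filter]; exact fun h => hix' h.2.1
      rw [heq]; exact hle k

/-- **Positive correlation of dominance-up families inside the outer shell** (Daykin's inequality in the lattice `Fin (n+1) → ℕ`).  Let `O = {x | outer x}` and let
`U, U' ⊆ O` be "prefix-upper": `x ∈ U`, `z ∈ O`, all prefix counts of `z` ≥ those of `x` ⇒ `z ∈ U`.  Then `#U · #U' ≤ #O · #(U ∩ U')`. [this work, memo §3.2] -/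
theorem card_mul_le_of_prefixUp (l : ℕ) (U U' : Finset (Finset (Fin n)))
    (hU : U ⊆ univ.filter fun s : Finset (Fin n) => #s < l ∨ #sᶜ < l) (hU' : U' ⊆ univ.filter fun s : Finset (Fin n) => #s < l ∨ #sᶜ < l)
    (hUp : ∀ x ∈ U, ∀ z : Finset (Fin n), (#z < l ∨ #zᶜ < l) → (∀ k : ℕ, #(x.filter fun a : Fin n => (a : ℕ) < k) ≤ #(z.filter fun a : Fin n => (a : ℕ) < k)) → z ∈ U)
    (hUp' : ∀ x ∈ U', ∀ z : Finset (Fin n), (#z < l ∨ #zᶜ < l) → (∀ k : ℕ, #(x.filter fun a : Fin n => (a : ℕ) < k) ≤ #(z.filter fun a : Fin n => (a : ℕ) < k)) → z ∈ U') :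
    #U * #U' ≤ #(univ.filter fun s : Finset (Fin n) => #s < l ∨ #sᶜ < l) * #(U ∩ U') := by
  classical
  set O := univ.filter fun s : Finset (Fin n) => #s < l ∨ #sᶜ < l with hO
  -- the prefix-count embedding into the distributive lattice `Fin (n+1) → ℕ`
  set E : Finset (Fin n) → (Fin (n + 1) → ℕ) := fun x k => #(x.filter fun a : Fin n => (a : ℕ) < (k : ℕ)) with hE
  have hcardE : ∀ x : Finset (Fin n), E x (Fin.last n) = #x := fun x => by
    simp only [hE, Fin.val_last]; exact card_filter_lt_of_le x n le_rfl
  have hEinj : Function.Injective E := by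
    intro x y h
    ext a
    have h0 := congrFun h ⟨a, Nat.lt_succ_of_lt a.2⟩
    have h1 := congrFun h ⟨a + 1, Nat.succ_lt_succ a.2⟩
    simp only [hE] at h0 h1
    rw [card_filter_lt_succ x a a.2, card_filter_lt_succ y a a.2, h0] at h1
    have ha : (⟨(a : ℕ), a.2⟩ : Fin n) = a := Fin.ext rfl
    rw [ha] at h1
    by_cases hx : a ∈ x <;> by_cases hy : a ∈ y <;> simp only [hx, hy, if_true, if_false] at h1 <;> first | omega | tauto
  have hmem : ∀ z : Finset (Fin n), z ∈ O ↔ (#z < l ∨ #zᶜ < l) := fun z => by rw [hO, mem_filter]; simp only [mem_univ, true_and]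
  have houter : ∀ x y z : Finset (Fin n), x ∈ O → y ∈ O → (#z = max #x #y ∨ #z = min #x #y) → z ∈ O := by
    intro x y z hx hy hz
    rw [hmem] at hx hy ⊢
    rw [card_compl, Fintype.card_fin] at hx hy ⊢
    rcases hz with hz | hz <;> rw [hz] <;> rcases le_total #x #y with h | h <;>
      simp only [max_eq_right h, max_eq_left h, min_eq_left h, min_eq_right h] <;> omega
  -- joins land in `U ∩ U'`, meets in `O`
  have hsups : (U.image E) ⊻ (U'.image E) ⊆ (U ∩ U').image E := by
    intro v hv
    rw [mem_sups] at hv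
    obtain ⟨a, ha, b, hb, rfl⟩ := hv
    obtain ⟨x, hx, rfl⟩ := mem_image.1 ha
    obtain ⟨y, hy, rfl⟩ := mem_image.1 hb
    obtain ⟨z, hz⟩ := exists_prefix_eq_max x y
    have hEz : E x ⊔ E y = E z := by funext k; simp only [hE, Pi.sup_apply]; rw [hz k]
    rw [hEz, mem_image]
    have hzc : #z = max #x #y := by
      have h := hz n
      rwa [card_filter_lt_of_le z n le_rfl, card_filter_lt_of_le x n le_rfl, card_filter_lt_of_le y n le_rfl] at h
    have hzO : z ∈ O := houter x y z (hU hx) (hU' hy) (Or.inl hzc)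
    refine ⟨z, mem_inter.2 ⟨hUp x hx z ((hmem z).1 hzO) fun k => ?_, hUp' y hy z ((hmem z).1 hzO) fun k => ?_⟩, rfl⟩
    · rw [hz k]; exact le_max_left _ _
    · rw [hz k]; exact le_max_right _ _
  have hinfs : (U.image E) ⊼ (U'.image E) ⊆ O.image E := by
    intro v hv
    rw [mem_infs] at hv
    obtain ⟨a, ha, b, hb, rfl⟩ := hv
    obtain ⟨x, hx, rfl⟩ := mem_image.1 ha
    obtain ⟨y, hy, rfl⟩ := mem_image.1 hb
    obtain ⟨z, hz⟩ := exists_prefix_eq_min x y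
    have hEz : E x ⊓ E y = E z := by funext k; simp only [hE, Pi.inf_apply]; rw [hz k]
    rw [hEz, mem_image]
    have hzc : #z = min #x #y := by
      have h := hz n
      rwa [card_filter_lt_of_le z n le_rfl, card_filter_lt_of_le x n le_rfl, card_filter_lt_of_le y n le_rfl] at h
    exact ⟨z, houter x y z (hU hx) (hU' hy) (Or.inr hzc), rfl⟩
  have hD := (U.image E).le_card_infs_mul_card_sups (U'.image E)
  rw [card_image_of_injective _ hEinj, card_image_of_injective _ hEinj] at hD
  calc #U * #U' ≤ #((U.image E) ⊼ (U'.image E)) * #((U.image E) ⊻ (U'.image E)) := hD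
    _ ≤ #(O.image E) * #((U ∩ U').image E) := Nat.mul_le_mul (card_le_card hinfs) (card_le_card hsups)
    _ = #O * #(U ∩ U') := by rw [card_image_of_injective _ hEinj, card_image_of_injective _ hEinj]

/-- **(AB_l) for EQUALLY shifted pairs.**  If `W` and `V` are upper sets of `2^{Fin n}`, both left-shifted (compressed along `({i},{j})` for all `i < j`), then for every `l`:
`#{s ∈ W ∩ Vᶜˢ | #s < l ∨ #sᶜ < l} ≤ #{s ∈ W ∩ V | #s < l ∨ #sᶜ < l}`.  (By the symmetry `i ↦ n−1−i` the same holds for two right-shifted upper sets.)  Proof: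
`F = #(U ∩ U') + #(U ∩ U'') − #U` with `U = W ∩ O`, `U' = V ∩ O`, `U'' = {x ∈ O | xᶜ ∉ V}`, `#U' + #U'' = #O`, and two applications of `card_mul_le_of_prefixUp`.
[this work, memo §3.2] -/
theorem antiBand_of_both_leftShifted (l : ℕ) (W V : Finset (Finset (Fin n)))
    (hW : IsUpperSet (W : Set (Finset (Fin n)))) (hV : IsUpperSet (V : Set (Finset (Fin n))))
    (hWsh : ∀ i j : Fin n, i < j → UV.IsCompressed ({i} : Finset (Fin n)) {j} W)
    (hVsh : ∀ i j : Fin n, i < j → UV.IsCompressed ({i} : Finset (Fin n)) {j} V) :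
    #((W ∩ Vᶜˢ).filter fun s => #s < l ∨ #sᶜ < l) ≤ #((W ∩ V).filter fun s => #s < l ∨ #sᶜ < l) := by
  classical
  set O := univ.filter fun s : Finset (Fin n) => #s < l ∨ #sᶜ < l with hO
  have hmem : ∀ z : Finset (Fin n), z ∈ O ↔ (#z < l ∨ #zᶜ < l) := fun z => by rw [hO, mem_filter]; simp only [mem_univ, true_and]
  set U := W.filter fun s => #s < l ∨ #sᶜ < l with hU
  set U' := V.filter fun s => #s < l ∨ #sᶜ < l with hU'
  set U'' := O.filter fun s => sᶜ ∉ V with hU''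
  -- prefix-count facts for complements: `#{a ∈ sᶜ | a < k} + #{a ∈ s | a < k}` does not depend on `s`
  have hcompl : ∀ (s : Finset (Fin n)) (k : ℕ), #(sᶜ.filter fun a : Fin n => (a : ℕ) < k) + #(s.filter fun a : Fin n => (a : ℕ) < k)
      = #((univ : Finset (Fin n)).filter fun a : Fin n => (a : ℕ) < k) := by
    intro s k
    rw [← card_union_of_disjoint (disjoint_filter_filter (compl_eq_univ_sdiff s ▸ sdiff_disjoint : Disjoint sᶜ s)), ← filter_union,
      compl_eq_univ_sdiff, sdiff_union_of_subset (subset_univ s)]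
  -- the three families are prefix-upper inside `O`
  have hUp : ∀ x ∈ U, ∀ z : Finset (Fin n), (#z < l ∨ #zᶜ < l) →
      (∀ k : ℕ, #(x.filter fun a : Fin n => (a : ℕ) < k) ≤ #(z.filter fun a : Fin n => (a : ℕ) < k)) → z ∈ U := by
    intro x hx z hz hle
    rw [hU, mem_filter] at hx ⊢
    exact ⟨mem_of_prefix_le W hW hWsh _ x z rfl hx.1 hle, hz⟩
  have hUp' : ∀ x ∈ U', ∀ z : Finset (Fin n), (#z < l ∨ #zᶜ < l) →
      (∀ k : ℕ, #(x.filter fun a : Fin n => (a : ℕ) < k) ≤ #(z.filter fun a : Fin n => (a : ℕ) < k)) → z ∈ U' := by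
    intro x hx z hz hle
    rw [hU', mem_filter] at hx ⊢
    exact ⟨mem_of_prefix_le V hV hVsh _ x z rfl hx.1 hle, hz⟩
  have hUp'' : ∀ x ∈ U'', ∀ z : Finset (Fin n), (#z < l ∨ #zᶜ < l) →
      (∀ k : ℕ, #(x.filter fun a : Fin n => (a : ℕ) < k) ≤ #(z.filter fun a : Fin n => (a : ℕ) < k)) → z ∈ U'' := by
    intro x hx z hz hle
    rw [hU'', mem_filter] at hx ⊢
    refine ⟨(hmem z).2 hz, fun hzV => hx.2 (mem_of_prefix_le V hV hVsh _ zᶜ xᶜ rfl hzV fun k => ?_)⟩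
    have h1 := hcompl x k; have h2 := hcompl z k; have h3 := hle k; omega
  have hUO : U ⊆ O := fun s hs => by rw [hU, mem_filter] at hs; exact (hmem s).2 hs.2
  have hU'O : U' ⊆ O := fun s hs => by rw [hU', mem_filter] at hs; exact (hmem s).2 hs.2
  have hU''O : U'' ⊆ O := filter_subset _ _
  have hD1 := card_mul_le_of_prefixUp l U U' hUO hU'O hUp hUp'
  have hD2 := card_mul_le_of_prefixUp l U U'' hUO hU''O hUp hUp''
  -- `#U' + #U'' = #O` (complementation is a bijection of `O`)
  have hsum : #U' + #U'' = #O := by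
    have hsplit : #(O.filter fun s => sᶜ ∈ V) + #U'' = #O := by rw [hU'']; exact card_filter_add_card_filter_not _
    have hbij : #(O.filter fun s => sᶜ ∈ V) = #U' := by
      refine card_bij (fun s _ => sᶜ) (fun s hs => ?_) (fun s₁ _ s₂ _ h => compl_injective h) (fun s hs => ?_)
      · rw [mem_filter, hmem] at hs; rw [hU', mem_filter, compl_compl]; exact ⟨hs.2, hs.1.symm⟩
      · rw [hU', mem_filter] at hs
        refine ⟨sᶜ, ?_, compl_compl s⟩
        rw [mem_filter, hmem, compl_compl]; exact ⟨hs.2.symm, hs.1⟩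
    omega
  -- rewrite both sides of (AB) in terms of `U, U', U''`
  have hL : (W ∩ Vᶜˢ).filter (fun s => #s < l ∨ #sᶜ < l) = U \ U'' := by
    ext s
    rw [mem_filter, mem_inter, mem_compls, mem_sdiff, hU, mem_filter, hU'', mem_filter, hmem]
    tauto
  have hR : (W ∩ V).filter (fun s => #s < l ∨ #sᶜ < l) = U ∩ U' := by
    ext s; rw [mem_filter, mem_inter, hU, hU', mem_inter, mem_filter, mem_filter]; tauto
  rw [hL, hR]
  have hsplit := card_sdiff_add_card_inter U U''
  have hkey : #O * #U ≤ #O * (#(U ∩ U') + #(U ∩ U'')) := by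
    have h := add_le_add hD1 hD2
    rw [← mul_add, hsum, mul_comm] at h
    rwa [mul_add]
  by_cases hO0 : #O = 0
  · have hU0 : U = ∅ := by
      rw [card_eq_zero] at hO0; exact subset_empty.1 (hO0 ▸ hUO)
    rw [hU0, empty_sdiff, card_empty]; exact Nat.zero_le _
  · have := Nat.le_of_mul_le_mul_left hkey (Nat.pos_of_ne_zero hO0)
    omega

end Summit.CriticalPhenomena.PercolationContinuityZ3.Theorems.AntiBandDominance
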